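import Summits.KontsevichZagierPeriods.KontsevichZagierPeriods.Theses.UnfoldedStokes
import Summits.KontsevichZagierPeriods.KontsevichZagierPeriods.Theorems.GenusTwoCycleTransfer.Negative.Witnesses
import Literature.NumberTheory.Transcendental.SemialgebraicMapsProofs
import Literature.NumberTheory.Transcendental.KZLogCalculusProofs

/-!
# `HyperellipticRiemannRelation` (stmt-KontsevichZagierPeriods-3522) — negative knowledge, part 2: the canonical witnesses

Support file for the crux `UnfoldedStokes.HyperellipticRiemannRelation` (cdisprove seat, cycle 1;
work file `Cruxes/HyperellipticRiemannRelation/Disproof.lean`). At the configuration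
`e = (0,1,2,3,5)` (quintic `f(t) = t(t−1)(t−2)(t−3)(t−5)`, bounded gaps `J₁ = (0,1)`,
`J₂ = (1,2)`, `J₃ = (2,3)`, `J₄ = (3,5)`) the crux quantifies over representations
`r₁₂ r₁₄ r₃₄ : KZ.IntegralRep 2` on the boxes `J₁×J₂, J₁×J₄, J₃×J₄` whose integrand agrees there
with `G(x) = (x 1 − x 0)/√(|f(x 0)|·|f(x 1)|)`. This file shows that such representations EXIST
(so the crux is not vacuous at this `e`): the boxes are `ℚ`-semialgebraic; on each box
`|f(x 0)|·|f(x 1)| = −f(x 0)f(x 1) > 0`, so `G = (x 1 − x 0)·√(1/(−f(x 0)f(x 1)))` is a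
`ℚ`-semialgebraic function there; and `G` is absolutely integrable on each box, being dominated by
`5·u(x 0)·u(x 1)` with `u = 1/√|f|` integrable on every gap (model singularities
`(√(t−a))⁻¹ + (√(a+1−t))⁻¹` on the unit gaps, from `(t−a)(a+1−t) ≤ |f|`; `(√(t−3))⁻¹` on `(3,4)`
and `(√(5−t))⁻¹` on `[4,5)`), read on `ℝ × ℝ` through the volume-preserving
`MeasurableEquiv.finTwoArrow`. The one-variable facts on the real gaps `(0,1)`, `(2,3)` are those
of `Theorems/GenusTwoCycleTransfer/Negative/Witnesses` (same quintic). Also recorded: the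
zero-integrand representation on any `ℚ`-semialgebraic plane set (in particular on the EMPTY boxes
that a non-monotone `e` produces). No definitions or notations are introduced (the quintic and the
integrand are written out; the crux's own cast form `((![0,1,2,3,5] : Fin 5 → ℚ) i : ℝ)` is kept in
the integrand so that the witnesses instantiate the crux verbatim). Part 3 (`LoadBearing`) uses
these witnesses. [Kontsevich–Zagier 2001, §1.1] [folklore]
-/

noncomputable section

open Set MeasureTheory MvPolynomial
open Literature.NumberTheory.Transcendental Literature.ModelTheory.ExponentialFields
open Summit.KontsevichZagierPeriods.HermiteRigidity.GenusTwoCycleTransferNegative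

namespace Summit.KontsevichZagierPeriods.UnfoldedStokes.HyperellipticRiemannRelationNegative

/-! ### §1 The configuration `e = (0,1,2,3,5)` -/

/-- `(0,1,2,3,5)` is strictly increasing. [folklore] -/
theorem strictMono_e₀ : StrictMono (![0, 1, 2, 3, 5] : Fin 5 → ℚ) := by
  refine Fin.strictMono_iff_lt_succ.2 fun i => ?_
  fin_cases i <;> simp <;> norm_num

/-- The crux's product `∏ (t − e i)` at `e = (0,1,2,3,5)` is the quintic `f`. [folklore] -/
theorem prod_e₀ (t : ℝ) :
    ∏ i : Fin 5, (t - ((![0, 1, 2, 3, 5] : Fin 5 → ℚ) i : ℝ)) = t * (t - 1) * (t - 2) * (t - 3) * (t - 5) := by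
  simp [Fin.prod_univ_five]

/-- The crux integrand at `e = (0,1,2,3,5)`, written with the quintic `f`. [folklore] -/
theorem integrand_e₀ (x : Fin 2 → ℝ) :
    (x 1 - x 0) / Real.sqrt (|∏ i : Fin 5, (x 0 - ((![0, 1, 2, 3, 5] : Fin 5 → ℚ) i : ℝ))| *
      |∏ i : Fin 5, (x 1 - ((![0, 1, 2, 3, 5] : Fin 5 → ℚ) i : ℝ))|) =
    (x 1 - x 0) / Real.sqrt (|x 0 * (x 0 - 1) * (x 0 - 2) * (x 0 - 3) * (x 0 - 5)| *
      |x 1 * (x 1 - 1) * (x 1 - 2) * (x 1 - 3) * (x 1 - 5)|) := by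
  rw [prod_e₀, prod_e₀]

/-! ### §2 The quintic on the imaginary gaps `(1,2)` and `(3,5)` -/

/-- On `(1,2)`: `(t−1)(2−t) ≤ −f(t)` (the cofactor `t(3−t)(5−t)` is `≥ 1`). [folklore] -/
theorem neg_quintic_ge_12 {t : ℝ} (ht : t ∈ Ioo (1:ℝ) 2) :
    (t - 1) * (1 + 1 - t) ≤ -(t * (t - 1) * (t - 2) * (t - 3) * (t - 5)) := by
  have hg : (1:ℝ) ≤ t * ((3 - t) * (5 - t)) :=
    one_le_mul_of_one_le_of_one_le (by linarith [ht.1])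
      (one_le_mul_of_one_le_of_one_le (by linarith [ht.2]) (by linarith [ht.2]))
  have h0 : 0 ≤ (t - 1) * (2 - t) := mul_nonneg (by linarith [ht.1]) (by linarith [ht.2])
  have : -(t * (t - 1) * (t - 2) * (t - 3) * (t - 5)) = (t - 1) * (2 - t) * (t * ((3 - t) * (5 - t))) := by
    ring
  rw [this]
  calc (t - 1) * (1 + 1 - t) = (t - 1) * (2 - t) * 1 := by ring
    _ ≤ (t - 1) * (2 - t) * (t * ((3 - t) * (5 - t))) := mul_le_mul_of_nonneg_left hg h0

/-- `f < 0` on `(1,2)`. [folklore] -/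
theorem quintic_neg_12 {t : ℝ} (ht : t ∈ Ioo (1:ℝ) 2) : t * (t - 1) * (t - 2) * (t - 3) * (t - 5) < 0 := by
  have h : 0 < (t - 1) * (1 + 1 - t) := mul_pos (by linarith [ht.1]) (by linarith [ht.2])
  linarith [neg_quintic_ge_12 ht]

/-- On `(3,4)`: `t − 3 ≤ −f(t)` (cofactor `t(t−1)(t−2)(5−t) ≥ 1`). [folklore] -/
theorem neg_quintic_ge_34 {t : ℝ} (ht : t ∈ Ioo (3:ℝ) 4) :
    t - 3 ≤ -(t * (t - 1) * (t - 2) * (t - 3) * (t - 5)) := by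
  have hg : (1:ℝ) ≤ t * (t - 1) * (t - 2) * (5 - t) :=
    one_le_mul_of_one_le_of_one_le (one_le_mul_of_one_le_of_one_le
      (one_le_mul_of_one_le_of_one_le (by linarith [ht.1]) (by linarith [ht.1]))
      (by linarith [ht.1])) (by linarith [ht.2])
  have h0 : 0 ≤ t - 3 := by linarith [ht.1]
  have : -(t * (t - 1) * (t - 2) * (t - 3) * (t - 5)) = (t - 3) * (t * (t - 1) * (t - 2) * (5 - t)) := by
    ring
  rw [this]
  calc t - 3 = (t - 3) * 1 := by ring
    _ ≤ (t - 3) * (t * (t - 1) * (t - 2) * (5 - t)) := mul_le_mul_of_nonneg_left hg h0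

/-- On `(4,5)`: `5 − t ≤ −f(t)` (cofactor `t(t−1)(t−2)(t−3) ≥ 1`). [folklore] -/
theorem neg_quintic_ge_45 {t : ℝ} (ht : t ∈ Ioo (4:ℝ) 5) :
    5 - t ≤ -(t * (t - 1) * (t - 2) * (t - 3) * (t - 5)) := by
  have hg : (1:ℝ) ≤ t * (t - 1) * (t - 2) * (t - 3) :=
    one_le_mul_of_one_le_of_one_le (one_le_mul_of_one_le_of_one_le
      (one_le_mul_of_one_le_of_one_le (by linarith [ht.1]) (by linarith [ht.1]))
      (by linarith [ht.1])) (by linarith [ht.1])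
  have h0 : 0 ≤ 5 - t := by linarith [ht.2]
  have : -(t * (t - 1) * (t - 2) * (t - 3) * (t - 5)) = (5 - t) * (t * (t - 1) * (t - 2) * (t - 3)) := by
    ring
  rw [this]
  calc 5 - t = (5 - t) * 1 := by ring
    _ ≤ (5 - t) * (t * (t - 1) * (t - 2) * (t - 3)) := mul_le_mul_of_nonneg_left hg h0

/-- `f < 0` on `(3,5)`. [folklore] -/
theorem quintic_neg_35 {t : ℝ} (ht : t ∈ Ioo (3:ℝ) 5) : t * (t - 1) * (t - 2) * (t - 3) * (t - 5) < 0 := by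
  have h1 : 0 < t * (t - 1) * (t - 2) * (t - 3) :=
    mul_pos (mul_pos (mul_pos (by linarith [ht.1]) (by linarith [ht.1])) (by linarith [ht.1]))
      (by linarith [ht.1])
  have h2 : t - 5 < 0 := by linarith [ht.2]
  exact mul_neg_of_pos_of_neg h1 h2

/-! ### §3 `u = 1/√|f|` is integrable on the four bounded gaps -/

/-- `u = 1/√|f|` is Borel measurable. [folklore] -/
theorem measurable_u : Measurable (fun t : ℝ => 1 / Real.sqrt |t * (t - 1) * (t - 2) * (t - 3) * (t - 5)|) := by
  fun_prop

/-- `u` is integrable on the real gap `(0,1)` (there `|f| = f`; part 1 of crux 3408). [folklore] -/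
theorem integrableOn_u_01 :
    IntegrableOn (fun t : ℝ => 1 / Real.sqrt |t * (t - 1) * (t - 2) * (t - 3) * (t - 5)|) (Ioo 0 1) :=
  integrableOn_Ioo01.congr_fun (fun t ht => by rw [abs_of_pos (quintic_pos_01 ht)]) measurableSet_Ioo

/-- `u` is integrable on the real gap `(2,3)` (there `|f| = f`; part 1 of crux 3408). [folklore] -/
theorem integrableOn_u_23 :
    IntegrableOn (fun t : ℝ => 1 / Real.sqrt |t * (t - 1) * (t - 2) * (t - 3) * (t - 5)|) (Ioo 2 3) :=
  integrableOn_Ioo23.congr_fun (fun t ht => by rw [abs_of_pos (quintic_pos_23 ht)]) measurableSet_Ioo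

/-- `u` is integrable on the imaginary gap `(1,2)` (there `|f| = −f ≥ (t−1)(2−t)`). [folklore] -/
theorem integrableOn_u_12 :
    IntegrableOn (fun t : ℝ => 1 / Real.sqrt |t * (t - 1) * (t - 2) * (t - 3) * (t - 5)|) (Ioo 1 2) := by
  refine Integrable.mono' (integrableOn_model 1 (1 + 1) |>.mono_set (by norm_num))
    measurable_u.aestronglyMeasurable ?_
  filter_upwards [ae_restrict_mem measurableSet_Ioo] with t ht
  rw [Real.norm_of_nonneg (by positivity), abs_of_neg (quintic_neg_12 ht)]
  exact inv_sqrt_le_model (a := 1) (by norm_num at ht ⊢; exact ht) (neg_quintic_ge_12 ht)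

/-- `u` is integrable on `(3,4)` (`|f| = −f ≥ t − 3`, model `(√(t−3))⁻¹`). [folklore] -/
theorem integrableOn_u_34 :
    IntegrableOn (fun t : ℝ => 1 / Real.sqrt |t * (t - 1) * (t - 2) * (t - 3) * (t - 5)|) (Ioo 3 4) := by
  refine Integrable.mono' (KZ.integrableOn_inv_sqrt_sub_left 3 4) measurable_u.aestronglyMeasurable ?_
  filter_upwards [ae_restrict_mem measurableSet_Ioo] with t ht
  have ht5 : t ∈ Ioo (3:ℝ) 5 := ⟨ht.1, by linarith [ht.2]⟩
  rw [Real.norm_of_nonneg (by positivity), abs_of_neg (quintic_neg_35 ht5), one_div]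
  exact inv_anti₀ (Real.sqrt_pos.mpr (by linarith [ht.1])) (Real.sqrt_le_sqrt (neg_quintic_ge_34 ht))

/-- `u` is integrable on `(4,5)` (`|f| = −f ≥ 5 − t`, model `(√(5−t))⁻¹`). [folklore] -/
theorem integrableOn_u_45 :
    IntegrableOn (fun t : ℝ => 1 / Real.sqrt |t * (t - 1) * (t - 2) * (t - 3) * (t - 5)|) (Ioo 4 5) := by
  refine Integrable.mono' (KZ.integrableOn_inv_sqrt_sub_right 4 5) measurable_u.aestronglyMeasurable ?_
  filter_upwards [ae_restrict_mem measurableSet_Ioo] with t ht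
  have ht5 : t ∈ Ioo (3:ℝ) 5 := ⟨by linarith [ht.1], ht.2⟩
  rw [Real.norm_of_nonneg (by positivity), abs_of_neg (quintic_neg_35 ht5), one_div]
  exact inv_anti₀ (Real.sqrt_pos.mpr (by linarith [ht.2])) (Real.sqrt_le_sqrt (neg_quintic_ge_45 ht))

/-- `u` is integrable on the imaginary gap `(3,5)`. [folklore] -/
theorem integrableOn_u_35 :
    IntegrableOn (fun t : ℝ => 1 / Real.sqrt |t * (t - 1) * (t - 2) * (t - 3) * (t - 5)|) (Ioo 3 5) := by
  have : Ioo (3:ℝ) 5 = Ioo 3 4 ∪ Ico 4 5 := (Ioo_union_Ico_eq_Ioo (by norm_num) (by norm_num)).symm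
  rw [this]
  exact integrableOn_u_34.union ((integrableOn_Ico_iff_integrableOn_Ioo).mpr integrableOn_u_45)

/-! ### §4 The boxes: semialgebraicity, and integrability of the crux integrand -/

/-- A coordinate box with rational corners is `ℚ`-semialgebraic in `ℝ²`. [folklore] -/
theorem isSemialgebraic_box (a b c d : ℚ) :
    IsSemialgebraic ℚ {x : Fin 2 → ℝ | (a : ℝ) < x 0 ∧ x 0 < (b : ℝ) ∧ (c : ℝ) < x 1 ∧ x 1 < (d : ℝ)} := by
  have h1 := isSemialgebraic_setOf_eval_lt (k := ℚ) (R := ℝ) (C a : MvPolynomial (Fin 2) ℚ) (X 0)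
  have h2 := isSemialgebraic_setOf_eval_lt (k := ℚ) (R := ℝ) (X 0 : MvPolynomial (Fin 2) ℚ) (C b)
  have h3 := isSemialgebraic_setOf_eval_lt (k := ℚ) (R := ℝ) (C c : MvPolynomial (Fin 2) ℚ) (X 1)
  have h4 := isSemialgebraic_setOf_eval_lt (k := ℚ) (R := ℝ) (X 1 : MvPolynomial (Fin 2) ℚ) (C d)
  simp only [aeval_X, aeval_C, eq_ratCast] at h1 h2 h3 h4
  have hset : {x : Fin 2 → ℝ | (a : ℝ) < x 0 ∧ x 0 < (b : ℝ) ∧ (c : ℝ) < x 1 ∧ x 1 < (d : ℝ)} =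
      {x | (a : ℝ) < x 0} ∩ ({x | x 0 < (b : ℝ)} ∩ ({x | (c : ℝ) < x 1} ∩ {x | x 1 < (d : ℝ)})) := by
    ext x
    simp only [mem_setOf_eq, mem_inter_iff]
  rw [hset]
  exact h1.inter (h2.inter (h3.inter h4))

/-- Integrability of a product kernel `u(x 0)·u(x 1)` on a box from one-variable integrability on
its sides (Tonelli through `MeasurableEquiv.finTwoArrow`). [folklore] -/
theorem integrableOn_box_mul {u : ℝ → ℝ} {a b c d : ℝ} (hu1 : IntegrableOn u (Ioo a b))
    (hu2 : IntegrableOn u (Ioo c d)) :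
    IntegrableOn (fun x : Fin 2 → ℝ => u (x 0) * u (x 1)) {x | a < x 0 ∧ x 0 < b ∧ c < x 1 ∧ x 1 < d} := by
  have h1 : Integrable (fun z : ℝ × ℝ => u z.1 * u z.2)
      ((volume.restrict (Ioo a b)).prod (volume.restrict (Ioo c d))) := hu1.mul_prod hu2
  rw [Measure.prod_restrict, ← Measure.volume_eq_prod] at h1
  have h2 : IntegrableOn (fun z : ℝ × ℝ => u z.1 * u z.2) (Ioo a b ×ˢ Ioo c d) := h1
  have hpre : {x : Fin 2 → ℝ | a < x 0 ∧ x 0 < b ∧ c < x 1 ∧ x 1 < d} =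
      MeasurableEquiv.finTwoArrow ⁻¹' (Ioo a b ×ˢ Ioo c d) := by
    ext x; simp [MeasurableEquiv.finTwoArrow, and_assoc]
  rw [hpre]
  exact ((volume_preserving_finTwoArrow ℝ).integrableOn_comp_preimage
    (MeasurableEquiv.measurableEmbedding _)).mpr h2

/-- The crux integrand (at `e = (0,1,2,3,5)`) is Borel measurable. [folklore] -/
theorem measurable_integrand_e₀ : Measurable (fun x : Fin 2 → ℝ => (x 1 - x 0) /
    Real.sqrt (|∏ i : Fin 5, (x 0 - ((![0, 1, 2, 3, 5] : Fin 5 → ℚ) i : ℝ))| *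
      |∏ i : Fin 5, (x 1 - ((![0, 1, 2, 3, 5] : Fin 5 → ℚ) i : ℝ))|)) := by
  fun_prop

/-- **Absolute integrability on a box.** On a box `(a,b) × (c,d) ⊆ [0,5]²` with `b ≤ c` whose
sides carry an integrable `u = 1/√|f|`, the crux integrand is integrable: there
`0 ≤ G(x) = (x 1 − x 0)·u(x 0)·u(x 1) ≤ 5·u(x 0)·u(x 1)`. [folklore] -/
theorem integrableOn_integrand_box {a b c d : ℝ} (ha : 0 ≤ a) (hbc : b ≤ c) (hd : d ≤ 5)
    (hu1 : IntegrableOn (fun t : ℝ => 1 / Real.sqrt |t * (t - 1) * (t - 2) * (t - 3) * (t - 5)|) (Ioo a b))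
    (hu2 : IntegrableOn (fun t : ℝ => 1 / Real.sqrt |t * (t - 1) * (t - 2) * (t - 3) * (t - 5)|) (Ioo c d)) :
    IntegrableOn (fun x : Fin 2 → ℝ => (x 1 - x 0) /
      Real.sqrt (|∏ i : Fin 5, (x 0 - ((![0, 1, 2, 3, 5] : Fin 5 → ℚ) i : ℝ))| *
        |∏ i : Fin 5, (x 1 - ((![0, 1, 2, 3, 5] : Fin 5 → ℚ) i : ℝ))|))
      {x | a < x 0 ∧ x 0 < b ∧ c < x 1 ∧ x 1 < d} := by
  have hmeas : MeasurableSet {x : Fin 2 → ℝ | a < x 0 ∧ x 0 < b ∧ c < x 1 ∧ x 1 < d} :=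
    (measurableSet_lt measurable_const (measurable_pi_apply 0)).inter
      ((measurableSet_lt (measurable_pi_apply 0) measurable_const).inter
      ((measurableSet_lt measurable_const (measurable_pi_apply 1)).inter
      (measurableSet_lt (measurable_pi_apply 1) measurable_const)))
  refine Integrable.mono' ((integrableOn_box_mul hu1 hu2).const_mul 5)
    measurable_integrand_e₀.aestronglyMeasurable ?_
  filter_upwards [ae_restrict_mem hmeas] with x hx
  obtain ⟨h0a, h0b, h1c, h1d⟩ := hx
  rw [integrand_e₀]
  have hle : x 0 ≤ x 1 := by linarith
  have hnum : 0 ≤ x 1 - x 0 := sub_nonneg.2 hle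
  have hnum5 : x 1 - x 0 ≤ 5 := by linarith
  set A := |x 0 * (x 0 - 1) * (x 0 - 2) * (x 0 - 3) * (x 0 - 5)| with hA
  set B := |x 1 * (x 1 - 1) * (x 1 - 2) * (x 1 - 3) * (x 1 - 5)| with hB
  have hA0 : 0 ≤ A := abs_nonneg _
  have hsq : Real.sqrt (A * B) = Real.sqrt A * Real.sqrt B := Real.sqrt_mul hA0 B
  rw [Real.norm_of_nonneg (div_nonneg hnum (Real.sqrt_nonneg _)), hsq]
  have hprod : 0 ≤ 1 / Real.sqrt A * (1 / Real.sqrt B) := by positivity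
  calc (x 1 - x 0) / (Real.sqrt A * Real.sqrt B)
      = (x 1 - x 0) * (1 / Real.sqrt A * (1 / Real.sqrt B)) := by ring
    _ ≤ 5 * (1 / Real.sqrt A * (1 / Real.sqrt B)) := mul_le_mul_of_nonneg_right hnum5 hprod

/-- **Semialgebraicity of the integrand on a box** inside `{f(x 0) > 0} × {f(x 1) < 0}`: there
`|f(x 0)|·|f(x 1)| = −f(x 0)·f(x 1)` and `G = (x 1 − x 0)·√(1/(−f(x 0)f(x 1)))` — a polynomial times
the square root of a rational function with non-vanishing denominator
(`isSemialgebraicFunOn_aeval_div_aeval`, `IsSemialgebraicFunOn.sqrt_holds`, `mul_holds`).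
[cite: BochnakCosteRoy1998, Prop. 2.2.6] -/
theorem isSemialgebraicFunOn_integrand {σ : Set (Fin 2 → ℝ)} (hσ : IsSemialgebraic ℚ σ)
    (h0 : ∀ x ∈ σ, 0 < x 0 * (x 0 - 1) * (x 0 - 2) * (x 0 - 3) * (x 0 - 5))
    (h1 : ∀ x ∈ σ, x 1 * (x 1 - 1) * (x 1 - 2) * (x 1 - 3) * (x 1 - 5) < 0) :
    IsSemialgebraicFunOn ℚ σ (fun x : Fin 2 → ℝ => (x 1 - x 0) /
      Real.sqrt (|∏ i : Fin 5, (x 0 - ((![0, 1, 2, 3, 5] : Fin 5 → ℚ) i : ℝ))| *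
        |∏ i : Fin 5, (x 1 - ((![0, 1, 2, 3, 5] : Fin 5 → ℚ) i : ℝ))|)) := by
  -- the rational function 1 / (−f(x 0) f(x 1))
  have hq : ∀ x ∈ σ, aeval x (-((X 0 * (X 0 - 1) * (X 0 - 2) * (X 0 - 3) * (X 0 - 5)) *
      (X 1 * (X 1 - 1) * (X 1 - 2) * (X 1 - 3) * (X 1 - 5))) : MvPolynomial (Fin 2) ℚ) ≠ 0 := by
    intro x hx
    have := mul_neg_of_pos_of_neg (h0 x hx) (h1 x hx)
    simp only [map_neg, map_mul, map_sub, aeval_X, map_one, map_ofNat]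
    linarith
  have hrat := isSemialgebraicFunOn_aeval_div_aeval hσ (1 : MvPolynomial (Fin 2) ℚ) _ hq
  have hsqrt := IsSemialgebraicFunOn.sqrt_holds hrat
  have hlin := isSemialgebraicFunOn_aeval hσ (X 1 - X 0 : MvPolynomial (Fin 2) ℚ)
  have hmul := IsSemialgebraicFunOn.mul_holds hlin hsqrt
  refine hmul.congr fun x hx => ?_
  have hneg : x 0 * (x 0 - 1) * (x 0 - 2) * (x 0 - 3) * (x 0 - 5) *
      (x 1 * (x 1 - 1) * (x 1 - 2) * (x 1 - 3) * (x 1 - 5)) < 0 :=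
    mul_neg_of_pos_of_neg (h0 x hx) (h1 x hx)
  simp only [Pi.mul_apply, map_sub, aeval_X, map_one, map_neg, map_mul, map_ofNat]
  rw [integrand_e₀, ← abs_mul, abs_of_neg hneg, Real.sqrt_div' _ (by linarith), Real.sqrt_one]
  ring

/-- Builder: a representation `[σ, G]` exists on any `ℚ`-semialgebraic `σ ⊆ {f(x 0) > 0 > f(x 1)}`
on which `G` is integrable. [cite: KontsevichZagier2001, §1.1] -/
theorem exists_rep_of {σ : Set (Fin 2 → ℝ)} (hσ : IsSemialgebraic ℚ σ)
    (h0 : ∀ x ∈ σ, 0 < x 0 * (x 0 - 1) * (x 0 - 2) * (x 0 - 3) * (x 0 - 5))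
    (h1 : ∀ x ∈ σ, x 1 * (x 1 - 1) * (x 1 - 2) * (x 1 - 3) * (x 1 - 5) < 0)
    (hint : IntegrableOn (fun x : Fin 2 → ℝ => (x 1 - x 0) /
      Real.sqrt (|∏ i : Fin 5, (x 0 - ((![0, 1, 2, 3, 5] : Fin 5 → ℚ) i : ℝ))| *
        |∏ i : Fin 5, (x 1 - ((![0, 1, 2, 3, 5] : Fin 5 → ℚ) i : ℝ))|)) σ) :
    ∃ r : KZ.IntegralRep 2, r.domain = σ ∧ r.integrand = (fun x : Fin 2 → ℝ => (x 1 - x 0) /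
      Real.sqrt (|∏ i : Fin 5, (x 0 - ((![0, 1, 2, 3, 5] : Fin 5 → ℚ) i : ℝ))| *
        |∏ i : Fin 5, (x 1 - ((![0, 1, 2, 3, 5] : Fin 5 → ℚ) i : ℝ))|)) :=
  ⟨⟨σ, _, hσ, isSemialgebraicFunOn_integrand hσ h0 h1, hint⟩, rfl, rfl⟩

/-! ### §5 The witnesses -/

/-- **Witness on `J₁ × J₂ = (0,1) × (1,2)`**: an admissible `r₁₂` exists.
[cite: KontsevichZagier2001, §1.1] -/
theorem exists_rep₁₂ : ∃ r : KZ.IntegralRep 2,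
    r.domain = {x | (0:ℝ) < x 0 ∧ x 0 < 1 ∧ (1:ℝ) < x 1 ∧ x 1 < 2} ∧
    r.integrand = (fun x : Fin 2 → ℝ => (x 1 - x 0) /
      Real.sqrt (|∏ i : Fin 5, (x 0 - ((![0, 1, 2, 3, 5] : Fin 5 → ℚ) i : ℝ))| *
        |∏ i : Fin 5, (x 1 - ((![0, 1, 2, 3, 5] : Fin 5 → ℚ) i : ℝ))|)) := by
  have hσ := isSemialgebraic_box 0 1 1 2
  simp only [Rat.cast_zero, Rat.cast_one, Rat.cast_ofNat] at hσ
  exact exists_rep_of hσ (fun x hx => quintic_pos_01 ⟨hx.1, hx.2.1⟩)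
    (fun x hx => quintic_neg_12 ⟨hx.2.2.1, hx.2.2.2⟩)
    (integrableOn_integrand_box le_rfl le_rfl (by norm_num) integrableOn_u_01 integrableOn_u_12)

/-- **Witness on `J₁ × J₄ = (0,1) × (3,5)`**: an admissible `r₁₄` exists.
[cite: KontsevichZagier2001, §1.1] -/
theorem exists_rep₁₄ : ∃ r : KZ.IntegralRep 2,
    r.domain = {x | (0:ℝ) < x 0 ∧ x 0 < 1 ∧ (3:ℝ) < x 1 ∧ x 1 < 5} ∧
    r.integrand = (fun x : Fin 2 → ℝ => (x 1 - x 0) /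
      Real.sqrt (|∏ i : Fin 5, (x 0 - ((![0, 1, 2, 3, 5] : Fin 5 → ℚ) i : ℝ))| *
        |∏ i : Fin 5, (x 1 - ((![0, 1, 2, 3, 5] : Fin 5 → ℚ) i : ℝ))|)) := by
  have hσ := isSemialgebraic_box 0 1 3 5
  simp only [Rat.cast_zero, Rat.cast_one, Rat.cast_ofNat] at hσ
  exact exists_rep_of hσ (fun x hx => quintic_pos_01 ⟨hx.1, hx.2.1⟩)
    (fun x hx => quintic_neg_35 ⟨hx.2.2.1, hx.2.2.2⟩)
    (integrableOn_integrand_box le_rfl (by norm_num) le_rfl integrableOn_u_01 integrableOn_u_35)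

/-- **Witness on `J₃ × J₄ = (2,3) × (3,5)`**: an admissible `r₃₄` exists.
[cite: KontsevichZagier2001, §1.1] -/
theorem exists_rep₃₄ : ∃ r : KZ.IntegralRep 2,
    r.domain = {x | (2:ℝ) < x 0 ∧ x 0 < 3 ∧ (3:ℝ) < x 1 ∧ x 1 < 5} ∧
    r.integrand = (fun x : Fin 2 → ℝ => (x 1 - x 0) /
      Real.sqrt (|∏ i : Fin 5, (x 0 - ((![0, 1, 2, 3, 5] : Fin 5 → ℚ) i : ℝ))| *
        |∏ i : Fin 5, (x 1 - ((![0, 1, 2, 3, 5] : Fin 5 → ℚ) i : ℝ))|)) := by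
  have hσ := isSemialgebraic_box 2 3 3 5
  simp only [Rat.cast_ofNat] at hσ
  exact exists_rep_of hσ (fun x hx => quintic_pos_23 ⟨hx.1, hx.2.1⟩)
    (fun x hx => quintic_neg_35 ⟨hx.2.2.1, hx.2.2.2⟩)
    (integrableOn_integrand_box (by norm_num) le_rfl le_rfl integrableOn_u_23 integrableOn_u_35)

/-- The zero-integrand representation on a `ℚ`-semialgebraic plane set (value `0`; tree:
`KZ.exists_zeroRep`). It satisfies every DOMAIN hypothesis of the crux and, on an empty box,
every integrand hypothesis as well. [folklore] -/
theorem exists_zeroRep₂ {σ : Set (Fin 2 → ℝ)} (hσ : IsSemialgebraic ℚ σ) :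
    ∃ z : KZ.IntegralRep 2, z.domain = σ ∧ z.integrand = 0 ∧ z.value = 0 := by
  obtain ⟨z, hd, hi⟩ := KZ.exists_zeroRep hσ
  exact ⟨z, hd, hi, by simp [KZ.IntegralRep.value, hi]⟩

/-- The representation with EMPTY domain and the crux integrand (value `0`): it satisfies every
integrand hypothesis of the crux and none of the (non-degenerate) domain hypotheses. [folklore] -/
theorem exists_emptyRep₂ : ∃ r : KZ.IntegralRep 2, r.domain = ∅ ∧
    r.integrand = (fun x : Fin 2 → ℝ => (x 1 - x 0) /
      Real.sqrt (|∏ i : Fin 5, (x 0 - ((![0, 1, 2, 3, 5] : Fin 5 → ℚ) i : ℝ))| *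
        |∏ i : Fin 5, (x 1 - ((![0, 1, 2, 3, 5] : Fin 5 → ℚ) i : ℝ))|)) ∧ r.value = 0 :=
  ⟨⟨∅, _, isSemialgebraic_empty, (isSemialgebraicFunOn_aeval isSemialgebraic_empty 0).congr
    fun _ hx => hx.elim, integrableOn_empty⟩, rfl, rfl, by simp [KZ.IntegralRep.value]⟩

end Summit.KontsevichZagierPeriods.UnfoldedStokes.HyperellipticRiemannRelationNegative

end
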